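import Summits.QuantumFields.YangMills.Theorems.LuscherReductionDressedRitzLiftLeakageAllBasesLift
import HarnessLib

/-!
# Crux `DressedRitz` (stmt-QuantumFields-20205), line «polyakovlift», stub S-LEAK `stub_liftLeakage` — support X:
# cluster-CONSTANT approximate eigenvalues relaxed to fine clusters of WIDTH `δ` with `δ² ≲ ρ` (the quantitative form of the same-shell proviso)

Support module (fleet seat ym-20205-polyakovlift-s1; `--supports stmt-QuantumFields-20205`, helper, no closure claim).  Parts IV ∕ VII
(`residualLaw_allBases_of_reference[_lift]`) reduce the `∀`-basis residual law to ONE reference family under a CLUSTER-CONSTANT approximate eigenvalue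
`a(λ_n)` (exactly one value per exactly degenerate one-site level).  Physically the reference lifts of one one-site level are quasi-modes for a FINE
CLUSTER of width `O(λ²/L)λ₀` (first-order degenerate perturbation theory in both models; located finding F5 ∕ cdisprove (T2)), not for one common value.
Since `(λ²/L)² λ₀² = λ⁴/L²·λ₀² ≤ C(λ³/L²)λ₀²`, the right hypothesis is a cluster WIDTH `δ` with `δ²` of the order of the residual rate `ρ`.  This file
makes that precise:

* `residual_shift_le` (abstract): `ip((K−a)v,(K−a)v) ≤ 2·ip((K−a')v,(K−a')v) + 2(a−a')²·ip(v,v)`;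
* ★★ `residualLaw_allBases_of_reference_lift_width`: for ANY linear physical lift (r2 `liftVec β φ`, r3 `dressedLiftVec β φ`, any iterate): per-vector
  approximate eigenvalues `a_n` with (RL) `‖K v_n − a_n v_n‖² ≤ ρ‖v_n‖²`, (CW) `(a_n − a_{n'})² ≤ δ²` whenever `λ_n = λ_{n'}` (fine-cluster width), and (GR)
  in-cluster Gram control `Nγ ≤ 1/2` ⟹ every lift basis has `∃ a, ‖K u_i − a u_i‖² ≤ 4N(ρ + δ²)‖u_i‖²`, `u_i = lift g_i`.
  So S-LEAK's RG debt reads: residual rate `ρ` AND squared fine-cluster width `δ²` both `O(λ³/L²)λ₀²/N` — the second is the typed form of «same-`ε`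
  one-site levels lift into one fine cluster of width `O(λ²/L)λ₀`».

HONEST FRAMING: fixed-lattice bookkeeping on the conditional femto rung R2b1; (RL) ∕ (CW) ∕ (GR) are OPEN RG estimates; the stub stays OPEN; nothing here
bears on infinite volume, the continuum limit or the Clay gap.  References: T. Kato (1949) [cite: Kato1949, §1]; M. Lüscher, NPB 219 (1983) 233
[cite: Luscher1983, §3]; Reed–Simon IV Thm XIII.1 [cite: ReedSimonIV1978].
-/

set_option autoImplicit false

noncomputable section

open MeasureTheory Filter Topology Real Finset
open Literature.MathematicalPhysics.QuantumFieldTheory (GaugeConfig Site gaugeTransform)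
open scoped BigOperators

namespace Summit.QuantumFields.YangMills.Theorems.FemtoTransferGap.LiftLeak

open Summit.QuantumFields.YangMills.Theorems.FemtoTransferGap
open Summit.QuantumFields.YangMills.Theorems.FemtoTransferGap.PolyakovLift

section Abstract

variable {D : Type*} [AddCommGroup D] [Module ℝ D]

/-- **Shifting the approximate eigenvalue**: `ip((K−a)v,(K−a)v) ≤ 2·ip((K−a')v,(K−a')v) + 2(a−a')²·ip(v,v)` (`ip` symmetric positive semidefinite;
`(K−a)v = (K−a')v + (a'−a)v` and `ip(x+y,x+y) ≤ 2ip(x,x) + 2ip(y,y)`). [folklore] -/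
theorem residual_shift_le (ip : D →ₗ[ℝ] D →ₗ[ℝ] ℝ) (hip : ∀ x y, ip x y = ip y x) (hip0 : ∀ y, 0 ≤ ip y y) (K : D →ₗ[ℝ] D)
    (v : D) (a a' : ℝ) :
    ip (K v - a • v) (K v - a • v) ≤ 2 * ip (K v - a' • v) (K v - a' • v) + 2 * (a - a') ^ 2 * ip v v := by
  set x : D := K v - a' • v with hx
  set y : D := (a' - a) • v with hy
  have hdec : K v - a • v = x + y := by rw [hx, hy, sub_smul]; abel
  have hpar : ip (x + y) (x + y) ≤ 2 * ip x x + 2 * ip y y := by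
    have h0 := hip0 (x - y)
    have e1 : ip (x + y) (x + y) = ip x x + 2 * ip x y + ip y y := by
      simp only [map_add, LinearMap.add_apply, hip y x]; ring
    have e2 : ip (x - y) (x - y) = ip x x - 2 * ip x y + ip y y := by
      simp only [map_sub, LinearMap.sub_apply, hip y x]; ring
    rw [e2] at h0
    rw [e1]
    linarith
  have hyy : ip y y = (a - a') ^ 2 * ip v v := by
    simp only [hy, map_smul, LinearMap.smul_apply, smul_eq_mul]; ring
  rw [hdec]
  calc ip (x + y) (x + y) ≤ 2 * ip x x + 2 * ip y y := hpar
    _ = 2 * ip (K v - a' • v) (K v - a' • v) + 2 * (a - a') ^ 2 * ip v v := by rw [hyy, hx]; ring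

end Abstract

variable {L : ℕ} [NeZero L]

/-- **Shifting the approximate eigenvalue, femto currency**: for a physical `v` and reals `a, a'`,
`‖K_βv − a·v‖² ≤ 2‖K_βv − a'·v‖² + 2(a−a')²‖v‖²`. [folklore] -/
theorem residual_shift_le_l2 (β : ℝ) {v : GaugeConfig 3 L SU2 → ℝ} (hv : IsPhys v) (a a' : ℝ) :
    l2 (transferApply β v - a • v) (transferApply β v - a • v) ≤
      2 * l2 (transferApply β v - a' • v) (transferApply β v - a' • v) + 2 * (a - a') ^ 2 * l2 v v := by
  have h := residual_shift_le (l2Form L) l2Form_symm l2Form_self_nonneg (transferOp β) ⟨v, hv⟩ a a'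
  simpa only [l2Form_apply, coe_transferOp, Submodule.coe_sub, Submodule.coe_smul, Submodule.coe_mk] using h

/-- ★★ **Residual law for EVERY lift basis from one reference family with fine clusters of WIDTH `δ`** (any linear physical `lift`).  Reference data as
in `residualLaw_allBases_of_reference_lift`; per-vector approximate eigenvalues `a : Fin N → ℝ` with (RL) `‖K_β v_n − a_n·v_n‖² ≤ ρ‖v_n‖²`, (CW)
`(a_n − a_{n'})² ≤ δ²` whenever `λ_n = λ_{n'}`, (GR) `|⟨v_n,v_{n'}⟩| ≤ γ‖v_n‖‖v_{n'}‖` (`n ≠ n'`, `λ_n = λ_{n'}`), `Nγ ≤ 1/2`.  Then every lift basis `(ω,g)` has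
`∃ a', ‖K_β(lift g_i) − a'·lift g_i‖² ≤ 4N(ρ + δ²)‖lift g_i‖²`. [cite: Luscher1983, §3] [cite: Kato1949, §1] [cite: ReedSimonIV1978, Thm XIII.1] -/
theorem residualLaw_allBases_of_reference_lift_width (β : ℝ)
    (lift : (GaugeConfig 3 1 SU2 → ℝ) → (GaugeConfig 3 L SU2 → ℝ))
    (hlin : ∀ {N : ℕ} (f : Fin N → (GaugeConfig 3 1 SU2 → ℝ)) (c : Fin N → ℝ), (∀ n, IsPhys (f n)) →
      lift (fun V => ∑ n, c n * f n V) = ∑ n, c n • lift (f n))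
    (hphys : ∀ g : GaugeConfig 3 1 SU2 → ℝ, IsPhys g → IsPhys (lift g))
    {B : ℝ} (hB : 0 < B) (k : ℕ)
    {Ω₁ : GaugeConfig 3 1 SU2 → ℝ} (hΩ₁ : IsRawVacuum B Ω₁) (hpos : ∃ c : ℝ, 0 < c ∧ ∀ V, c ≤ Ω₁ V)
    {N : ℕ} {ψ : Fin N → (GaugeConfig 3 1 SU2 → ℝ)} (hψ : ∀ n, IsPhys (ψ n))
    (hon : ∀ n m, l2 (ψ n) (ψ m) = if n = m then 1 else 0) (ev : Fin N → ℝ) (heig : ∀ n, transferApply B (ψ n) = ev n • ψ n)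
    {Λ : ℝ} (hΛ : 0 ≤ Λ) (hΛk : Λ < levelValue su2Rep 1 B k)
    (hdom : ∀ χ : GaugeConfig 3 1 SU2 → ℝ, IsPhys χ → (∀ n, l2 χ (ψ n) = 0) → l2 χ (transferApply B χ) ≤ Λ * l2 χ χ)
    (a : Fin N → ℝ) {ρ δ γ : ℝ} (hρ : 0 ≤ ρ) (hγ : 0 ≤ γ) (hNγ : (N : ℝ) * γ ≤ 1 / 2)
    (hres : ∀ n, l2 (transferApply β (lift (ψ n / Ω₁)) - a n • lift (ψ n / Ω₁))
        (transferApply β (lift (ψ n / Ω₁)) - a n • lift (ψ n / Ω₁)) ≤ ρ * l2 (lift (ψ n / Ω₁)) (lift (ψ n / Ω₁)))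
    (hwidth : ∀ n n', ev n = ev n' → (a n - a n') ^ 2 ≤ δ ^ 2)
    (hgram : ∀ n n', n ≠ n' → ev n = ev n' →
      |l2 (lift (ψ n / Ω₁)) (lift (ψ n' / Ω₁))| ≤
        γ * (Real.sqrt (l2 (lift (ψ n / Ω₁)) (lift (ψ n / Ω₁))) * Real.sqrt (l2 (lift (ψ n' / Ω₁)) (lift (ψ n' / Ω₁)))))
    {ω : GaugeConfig 3 1 SU2 → ℝ} {g : Fin k → (GaugeConfig 3 1 SU2 → ℝ)} (hb : LiftBasis B k ω g) (i : Fin k) :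
    ∃ a' : ℝ, l2 (transferApply β (lift (g i)) - a' • lift (g i)) (transferApply β (lift (g i)) - a' • lift (g i)) ≤
      4 * N * (ρ + δ ^ 2) * l2 (lift (g i)) (lift (g i)) := by
  classical
  obtain ⟨c₁, hc₁, hc₁le⟩ := hpos
  -- one representative approximate eigenvalue per one-site level
  set aOf : ℝ → ℝ := fun μ => if hμ : ∃ n, ev n = μ then a (Classical.choose hμ) else 0 with haOf
  have haOf_near : ∀ n, (a n - aOf (ev n)) ^ 2 ≤ δ ^ 2 := by
    intro n
    have hμ : ∃ n', ev n' = ev n := ⟨n, rfl⟩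
    have hrep : ev (Classical.choose hμ) = ev n := Classical.choose_spec hμ
    have : aOf (ev n) = a (Classical.choose hμ) := by simp only [haOf, dif_pos hμ]
    rw [this]
    exact hwidth n _ hrep.symm
  have hf : ∀ n, IsPhys (ψ n / Ω₁) := fun n => OpPlat.isPhys_div (hψ n) hΩ₁.1 hc₁ hc₁le
  -- (RL) for the representative, rate `2(ρ + δ²)`
  have hres' : ∀ n, l2 (transferApply β (lift (ψ n / Ω₁)) - aOf (ev n) • lift (ψ n / Ω₁))
      (transferApply β (lift (ψ n / Ω₁)) - aOf (ev n) • lift (ψ n / Ω₁)) ≤ 2 * (ρ + δ ^ 2) * l2 (lift (ψ n / Ω₁)) (lift (ψ n / Ω₁)) := by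
    intro n
    have hshift := residual_shift_le_l2 β (hphys _ (hf n)) (aOf (ev n)) (a n)
    have hn0 : 0 ≤ l2 (lift (ψ n / Ω₁)) (lift (ψ n / Ω₁)) := l2_self_nonneg _
    have hsq : (aOf (ev n) - a n) ^ 2 ≤ δ ^ 2 := by rw [← neg_sub, neg_sq]; exact haOf_near n
    nlinarith [hres n, mul_le_mul_of_nonneg_right hsq hn0]
  have hρ' : 0 ≤ 2 * (ρ + δ ^ 2) := by positivity
  obtain ⟨a', ha'⟩ := residualLaw_allBases_of_reference_lift β lift hlin hphys hB k hΩ₁ ⟨c₁, hc₁, hc₁le⟩ hψ hon ev heig hΛ hΛk hdom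
    aOf hρ' hγ hNγ hres' hgram hb i
  exact ⟨a', ha'.trans (le_of_eq (by ring))⟩

end Summit.QuantumFields.YangMills.Theorems.FemtoTransferGap.LiftLeak

end
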